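import Summits.QuantumFields.BalabanUV.Beta.D1BFx.LiteralStencilSockets
import Summits.QuantumFields.BalabanUV.Beta.SymTablesAn1S2Weighted
import Summits.QuantumFields.BalabanUV.Beta.CombOneShotJetsTabs

/-!
# `BalabanUV.Beta.D1BFx.RoadLitPinAn1W` — road «BF-x» for binder row D1: **THE [S] SOCKETS OF PART 22″-lit's PIN, DISCHARGED** (an2 g58 RULING R-D1-g58-1 §2:
# «the sockets at `Jc″` are NOT S-sized: ZERO-SIZED — the literal's first-order slot does not see `w`»; bytes after an2's probe `gen58/probe/ProbeS2wSockets` 34191f2ce294e70c,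
# theirs to rename ∕ reshape; the road files first, leaf-01's `LiteralStencilSockets` §7 may absorb).  The pinned first-derivative family of PART 22″
# (`RoadEndBFxRoadScalesWFlatS.d1Rep_BFx_road_scales_W_flat_sbpS`, binder `S : ℕ → Fin 4 → (Fin 4 → ℤ) → MKer 4 (Fib 3)`) at the (III″) literal is the ODD-INDEXED PIN
# of d1-formalise-leaf-01's `LiteralStencilSockets` §6 at the DRESSED member of the chart-(III′) literal over an1's WEIGHTED record with the locks read through `Nat.log Lc`:
#   `S n := if h : Odd n then (JsB12CombShSym (Lc := n) h N (symTablesAn1S2w 3 n (cΛ (Nat.log Lc n)) (w (Nat.log Lc n))) (cΛ (Nat.log Lc n)) (cB (Nat.log Lc n)) 0).S else 0`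
# (so that at `n = Lc^m` it IS `(JcOfTabs hLc N (fun m ↦ symTablesAn1S2w 3 (Lc^m) (cΛ m) (w m)) cΛ cB m).S` — `S_at_pow`; the `.W` pin likewise — `W_at_pow`).  This file
# proves, in PART 22″'s EXACT binder shapes (`∀ n`, no parity hypothesis), the seven structural sockets `hScovB ∕ hSmm ∕ hSfm ∕ hSff ∕ hS ∕ hCs ∕ hδS` of that pin, every
# one BY NAME from leaf-01's per-datum DRESSED letters (`JsB12CombShSym_S_translate`, any record; `JsB12CombShSym_S_an1_inr_inr ∕ _inl_inr ∕ _inl_inl` through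
# the §0 transfer `JsB12CombShSym_S_w` — `.S` reads the record only through an1's `.V ∕ .H`), the datum's own `JetData.loc ∕ δ_pos`, and the `pin_*` wrappers.
# Nothing of the [M] rows, of (J2)-W or of [W] is touched.

HONEST DEPENDENCY (cell records, verbatim): «continuum YM on T⁴ ⇐ BetaPertH ∧ nine spine estimates (0/9 proved); BetaPertH ⇐ (D1) ∧ (D4) ∧
CAP+tail; G-an2-4 gates asym, D1 and NE2/3/4.»  HONEST FRAMING (cell contract, verbatim): «discharging `BetaPertH` makes Bałaban's UV stability
UNCONDITIONAL — a real constructive-QFT result; it is NOT the continuum limit and NOT the Clay problem.»  THIS MODULE DISCHARGES NOTHING of (J1),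
of (K), of D1 or of the wall: [folklore] `dif_pos ∕ dif_neg` bookkeeping over leaf-01's letters and two `funext` congruences.  No definition, no `def … : Prop`,
nothing cited, 0 sorry.  0 root-level binders of row D1 discharged; NOT D1, NOT `BetaPertH`, NOT continuum, NOT Clay.

ABSOLUTE RULE (cell charter, verbatim): «No internally-minted statement may enter as a cited fact. Every hypothesis is either kernel-proved in this
package or a verbatim quotation of a PUBLISHED theorem with page reference. The manuscript(s) under audit are NOT citable for their own disputed
steps — they are the thing under adjudication; programme-internal (2001/route/tribunal) claims are never citable.»

CONTENT (all [folklore]): §0 `dressAt_S_congr`, `dressSymAt_S_congr`, `JsB12CombSh0_S_w` (`rfl`), `JsB12CombShSym_S_w`, `trK_JsB12CombShSym_S_w`,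
`JsB12CombShSym_S_w_inr_inr ∕ _inl_inr ∕ _inl_inl`; §1 `S_at_odd`, `S_at_pow`, `W_at_pow`; §2 `S_covB` (`hScovB`), `S_inr_inr` (`hSmm`), `S_inl_inr` (`hSfm`),
`S_inl_inl` (`hSff`); §3 `S_locStencil` (`hS` with the pinned constants), `Cs_nonneg` (`hCs`), `δ_pos` (`hδS`).  Unit `b2b-balaban-beta-d1-p2` (road owner,
gen 31), 2026-08-25; generator `g31/gen/mk_f0.py` over `RoadHybPinAn1`'s tree bytes; no existing file touched.
-/

noncomputable section

namespace Summit.QuantumFields.BalabanUV.Beta.D1BFx.RoadLitPinAn1W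

open Literature.MathematicalPhysics.QuantumFieldTheory.Balaban1983to89
open Literature.MathematicalPhysics.QuantumFieldTheory.Balaban1983to89.Beta
open ExpKernelCalculus (MKer shiftK)
open OneStepResolventKernel (Fib JetData LocStencil)
open Summit.QuantumFields.BalabanUV.Beta.SymSecondOrderTablesAn1 (symTablesAn1S2)
open Summit.QuantumFields.BalabanUV.Beta.SymTablesAn1S2Weighted (symTablesAn1S2w)
open Summit.QuantumFields.BalabanUV.Beta.CombChartStepJets (JsB12CombSh0)
open Summit.QuantumFields.BalabanUV.Beta.CombChartJointEnd (JsB12CombShSym JsB12CombShSym_eq)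
open Summit.QuantumFields.BalabanUV.Beta.CombOneShotJetsTabs (JcOfTabs JcOfTabs_apply)
open Summit.QuantumFields.BalabanUV.Beta.AxialDressingRooted (dressAt dressAt_S)
open Summit.QuantumFields.BalabanUV.Beta.SymmetrisedDressingDress (dressSymAt dressSymAt_S)
open Summit.QuantumFields.BalabanUV.Beta.TameKernelCalculus (trK)
open Summit.QuantumFields.BalabanUV.Beta.BorderedHessian (sgnK)
open AffineAveraging (box)
open Summit.QuantumFields.BalabanUV.Beta.D1BFx.LiteralStencilSockets

/-! ## §0 The first-order slot does not see the second-order tables: transfers from an1's closed record to the weighted record (an2 g58's probe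
`gen58/probe/ProbeS2wSockets` 34191f2ce294e70c, R-D1-g58-1 §2 «zero-sized sockets») -/

section Transfer

/-- [folklore] `dressAt` reads only the `S` slot of its argument in its own `S` slot. -/
theorem dressAt_S_congr {d M : ℕ} [NeZero M] {r : Fin (d + 1) → ℕ} (hr : r ∈ box (d + 1) M) {J J' : JetData d M} (h : J.S = J'.S) :
    (dressAt hr J).S = (dressAt hr J').S := by
  funext κ u
  rw [dressAt_S, dressAt_S, h]

/-- [folklore] `dressSymAt` likewise. -/
theorem dressSymAt_S_congr {d M : ℕ} [NeZero M] {r : Fin (d + 1) → ℕ} (hr : r ∈ box (d + 1) M) {J J' : JetData d M} (h : J.S = J'.S) :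
    (dressSymAt hr J).S = (dressSymAt hr J').S := by
  funext κ u
  rw [dressSymAt_S, dressSymAt_S, h]

variable {n : ℕ} [NeZero n] (hn : Odd n) (N : ℕ) (c w cΛ cB : ℝ) (j : ℕ)

/-- [folklore] The RAW literal's `S` slot at the weighted record `symTablesAn1S2w 3 n c w` (any `c`, `w`) IS the one at an1's closed record `symTablesAn1S2 3 n cΛ`
(same pin `cΛ`): `.S = SrecOf V H GcombSh …` reads the record only through `.V ∕ .H`, which are an1's `symVhSAt ∕ symHessFFAt` in both (`rfl`). -/
theorem JsB12CombSh0_S_w :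
    (JsB12CombSh0 hn N (symTablesAn1S2w 3 n c w) cΛ cB j).S = (JsB12CombSh0 hn N (symTablesAn1S2 3 n cΛ) cΛ cB j).S := rfl

/-- [folklore] **THE DRESSED LITERAL's `S` SLOT AT THE WEIGHTED RECORD IS THE ONE AT an1's CLOSED RECORD** (through the two dressing congruences). -/
theorem JsB12CombShSym_S_w :
    (JsB12CombShSym hn N (symTablesAn1S2w 3 n c w) cΛ cB j).S = (JsB12CombShSym hn N (symTablesAn1S2 3 n cΛ) cΛ cB j).S := by
  rw [JsB12CombShSym_eq, JsB12CombShSym_eq]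
  exact dressSymAt_S_congr _ (dressAt_S_congr _ (JsB12CombSh0_S_w hn N c w cΛ cB j))

/-- [folklore] Row parity of the dressed `S` at the weighted record, unconditionally (leaf-01's `trK_JsB12CombShSym_S_an1` through the transfer). -/
theorem trK_JsB12CombShSym_S_w (κ : Fin 4) (u : Fin 4 → ℤ) :
    trK ((JsB12CombShSym hn N (symTablesAn1S2w 3 n c w) cΛ cB j).S κ u) = -sgnK ((JsB12CombShSym hn N (symTablesAn1S2w 3 n c w) cΛ cB j).S κ u) := by
  rw [JsB12CombShSym_S_w]
  exact trK_JsB12CombShSym_S_an1 hn N cΛ cB j κ u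

/-- [folklore] `hSmm` for the dressed literal at the weighted record (every level). -/
theorem JsB12CombShSym_S_w_inr_inr (κ : Fin 4) (u x y : Fin 4 → ℤ) (m m' : Fin 4) :
    (JsB12CombShSym hn N (symTablesAn1S2w 3 n c w) cΛ cB j).S κ u x y (Sum.inr m) (Sum.inr m') = 0 := by
  rw [JsB12CombShSym_S_w]
  exact JsB12CombShSym_S_an1_inr_inr hn N cΛ cB j κ u x y m m'

/-- [folklore] `hSfm` for the dressed literal at the weighted record (every level). -/
theorem JsB12CombShSym_S_w_inl_inr (κ : Fin 4) (u x y : Fin 4 → ℤ) (c' b : Fin 4) :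
    (JsB12CombShSym hn N (symTablesAn1S2w 3 n c w) cΛ cB j).S κ u x y (Sum.inl c') (Sum.inr b)
      = (JsB12CombShSym hn N (symTablesAn1S2w 3 n c w) cΛ cB j).S κ u y x (Sum.inr b) (Sum.inl c') := by
  rw [JsB12CombShSym_S_w]
  exact JsB12CombShSym_S_an1_inl_inr hn N cΛ cB j κ u x y c' b

/-- [folklore] `hSff` for the dressed literal at the weighted record (every level). -/
theorem JsB12CombShSym_S_w_inl_inl (κ : Fin 4) (u x y : Fin 4 → ℤ) (c' b : Fin 4) :
    (JsB12CombShSym hn N (symTablesAn1S2w 3 n c w) cΛ cB j).S κ u x y (Sum.inl c') (Sum.inl b)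
      = -(JsB12CombShSym hn N (symTablesAn1S2w 3 n c w) cΛ cB j).S κ u y x (Sum.inl b) (Sum.inl c') := by
  rw [JsB12CombShSym_S_w]
  exact JsB12CombShSym_S_an1_inl_inl hn N cΛ cB j κ u x y c' b

end Transfer

variable (Lc : ℕ) (N : ℕ) (w cΛ cB : ℕ → ℝ)

/-! ## §1 The pin read at odd blockings and at the scales -/

/-- [folklore] At an odd blocking the pin IS the dressed member's first-derivative family. -/
theorem S_at_odd {n : ℕ} (hn : Odd n) :
    (fun n : ℕ => if h : Odd n then (haveI : NeZero n := ⟨h.pos.ne'⟩;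
        (JsB12CombShSym (Lc := n) h N (symTablesAn1S2w 3 n (cΛ (Nat.log Lc n)) (w (Nat.log Lc n))) (cΛ (Nat.log Lc n)) (cB (Nat.log Lc n)) 0).S) else 0) n
      = (haveI : NeZero n := ⟨hn.pos.ne'⟩;
        (JsB12CombShSym (Lc := n) hn N (symTablesAn1S2w 3 n (cΛ (Nat.log Lc n)) (w (Nat.log Lc n))) (cΛ (Nat.log Lc n)) (cB (Nat.log Lc n)) 0).S) := by
  simp only [dif_pos hn]

/-- [folklore] **THE PIN AT THE SCALES**: at `n = Lc^m` (`Lc` odd, `1 < Lc`) the pin IS the first-order slot of the (III″) one-shot record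
`JcOfTabs hLc N (fun m ↦ symTablesAn1S2w 3 (Lc^m) (cΛ m) (w m)) cΛ cB m` (`Nat.log_pow`, `JcOfTabs_apply`) — PART 22″-lit's `hSpin` read at the scales. -/
theorem S_at_pow [NeZero Lc] (hLc : Odd Lc) (hL : 1 < Lc) (m : ℕ) :
    (fun n : ℕ => if h : Odd n then (haveI : NeZero n := ⟨h.pos.ne'⟩;
        (JsB12CombShSym (Lc := n) h N (symTablesAn1S2w 3 n (cΛ (Nat.log Lc n)) (w (Nat.log Lc n))) (cΛ (Nat.log Lc n)) (cB (Nat.log Lc n)) 0).S) else 0) (Lc ^ m)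
      = (JcOfTabs hLc N (fun m => symTablesAn1S2w 3 (Lc ^ m) (cΛ m) (w m)) cΛ cB m).S := by
  have h : Odd (Lc ^ m) := hLc.pow
  simp only [dif_pos h, Nat.log_pow hL, JcOfTabs_apply]

/-- [folklore] **THE SECOND-ORDER PIN AT THE SCALES**: the same for the `.W` slot — at `n = Lc^m` the odd-indexed pin of the dressed literal's second-order table IS
`(JcOfTabs hLc N (fun m ↦ symTablesAn1S2w 3 (Lc^m) (cΛ m) (w m)) cΛ cB m).W` (PART 22″-lit's `hWpin` read at the scales). -/
theorem W_at_pow [NeZero Lc] (hLc : Odd Lc) (hL : 1 < Lc) (m : ℕ) :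
    (fun n : ℕ => if h : Odd n then (haveI : NeZero n := ⟨h.pos.ne'⟩;
        (JsB12CombShSym (Lc := n) h N (symTablesAn1S2w 3 n (cΛ (Nat.log Lc n)) (w (Nat.log Lc n))) (cΛ (Nat.log Lc n)) (cB (Nat.log Lc n)) 0).W) else 0) (Lc ^ m)
      = (JcOfTabs hLc N (fun m => symTablesAn1S2w 3 (Lc ^ m) (cΛ m) (w m)) cΛ cB m).W := by
  have h : Odd (Lc ^ m) := hLc.pow
  simp only [dif_pos h, Nat.log_pow hL, JcOfTabs_apply]

/-! ## §2 The four entry sockets `hScovB ∕ hSmm ∕ hSfm ∕ hSff` -/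

/-- [folklore] **`hScovB` OF THE PIN**: block covariance at every blocking (odd: leaf-01's `JsB12CombShSym_S_translate`, any record; even: the zero family). -/
theorem S_covB (n : ℕ) (κ : Fin 4) (u t : Fin 4 → ℤ) :
    (fun n : ℕ => if h : Odd n then (haveI : NeZero n := ⟨h.pos.ne'⟩;
        (JsB12CombShSym (Lc := n) h N (symTablesAn1S2w 3 n (cΛ (Nat.log Lc n)) (w (Nat.log Lc n))) (cΛ (Nat.log Lc n)) (cB (Nat.log Lc n)) 0).S) else 0) n κ (u + ((n : ℕ) : ℤ) • t)
      = shiftK (-(((n : ℕ) : ℤ) • t)) ((fun n : ℕ => if h : Odd n then (haveI : NeZero n := ⟨h.pos.ne'⟩;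
        (JsB12CombShSym (Lc := n) h N (symTablesAn1S2w 3 n (cΛ (Nat.log Lc n)) (w (Nat.log Lc n))) (cΛ (Nat.log Lc n)) (cB (Nat.log Lc n)) 0).S) else 0) n κ u) :=
  pin_covB (fun n h => (haveI : NeZero n := ⟨h.pos.ne'⟩;
        (JsB12CombShSym (Lc := n) h N (symTablesAn1S2w 3 n (cΛ (Nat.log Lc n)) (w (Nat.log Lc n))) (cΛ (Nat.log Lc n)) (cB (Nat.log Lc n)) 0).S))
    (fun n h κ u t => by
    haveI : NeZero n := ⟨h.pos.ne'⟩
    exact JsB12CombShSym_S_translate h N _ _ _ 0 κ u t) n κ u t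

/-- [folklore] **`hSmm` OF THE PIN**: the multiplier–multiplier block vanishes. -/
theorem S_inr_inr (n : ℕ) (κ : Fin 4) (u x y : Fin 4 → ℤ) (c b : Fin 4) :
    (fun n : ℕ => if h : Odd n then (haveI : NeZero n := ⟨h.pos.ne'⟩;
        (JsB12CombShSym (Lc := n) h N (symTablesAn1S2w 3 n (cΛ (Nat.log Lc n)) (w (Nat.log Lc n))) (cΛ (Nat.log Lc n)) (cB (Nat.log Lc n)) 0).S) else 0) n κ u x y
        (Sum.inr c) (Sum.inr b) = 0 :=
  pin_entry_zero (fun n h => (haveI : NeZero n := ⟨h.pos.ne'⟩;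
        (JsB12CombShSym (Lc := n) h N (symTablesAn1S2w 3 n (cΛ (Nat.log Lc n)) (w (Nat.log Lc n))) (cΛ (Nat.log Lc n)) (cB (Nat.log Lc n)) 0).S))
    (Sum.inr c) (Sum.inr b) (fun n h κ u x y => by
    haveI : NeZero n := ⟨h.pos.ne'⟩
    exact JsB12CombShSym_S_w_inr_inr h N _ _ _ _ 0 κ u x y c b) n κ u x y

/-- [folklore] **`hSfm` OF THE PIN**: `S n κ u x y (inl c) (inr b) = S n κ u y x (inr b) (inl c)`. -/
theorem S_inl_inr (n : ℕ) (κ : Fin 4) (u x y : Fin 4 → ℤ) (c b : Fin 4) :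
    (fun n : ℕ => if h : Odd n then (haveI : NeZero n := ⟨h.pos.ne'⟩;
        (JsB12CombShSym (Lc := n) h N (symTablesAn1S2w 3 n (cΛ (Nat.log Lc n)) (w (Nat.log Lc n))) (cΛ (Nat.log Lc n)) (cB (Nat.log Lc n)) 0).S) else 0) n κ u x y
        (Sum.inl c) (Sum.inr b)
      = (fun n : ℕ => if h : Odd n then (haveI : NeZero n := ⟨h.pos.ne'⟩;
        (JsB12CombShSym (Lc := n) h N (symTablesAn1S2w 3 n (cΛ (Nat.log Lc n)) (w (Nat.log Lc n))) (cΛ (Nat.log Lc n)) (cB (Nat.log Lc n)) 0).S) else 0) n κ u y x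
        (Sum.inr b) (Sum.inl c) := by
  have h := pin_entry (fun n h => (haveI : NeZero n := ⟨h.pos.ne'⟩;
        (JsB12CombShSym (Lc := n) h N (symTablesAn1S2w 3 n (cΛ (Nat.log Lc n)) (w (Nat.log Lc n))) (cΛ (Nat.log Lc n)) (cB (Nat.log Lc n)) 0).S))
    1 (Sum.inl c) (Sum.inr b) (Sum.inl c) (Sum.inr b) (fun n h κ u x y => by
    haveI : NeZero n := ⟨h.pos.ne'⟩
    rw [one_mul]
    exact JsB12CombShSym_S_w_inl_inr h N _ _ _ _ 0 κ u x y c b) n κ u x y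
  rw [one_mul] at h
  exact h

/-- [folklore] **`hSff` OF THE PIN**: `S n κ u x y (inl c) (inl b) = −S n κ u y x (inl b) (inl c)`. -/
theorem S_inl_inl (n : ℕ) (κ : Fin 4) (u x y : Fin 4 → ℤ) (c b : Fin 4) :
    (fun n : ℕ => if h : Odd n then (haveI : NeZero n := ⟨h.pos.ne'⟩;
        (JsB12CombShSym (Lc := n) h N (symTablesAn1S2w 3 n (cΛ (Nat.log Lc n)) (w (Nat.log Lc n))) (cΛ (Nat.log Lc n)) (cB (Nat.log Lc n)) 0).S) else 0) n κ u x y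
        (Sum.inl c) (Sum.inl b)
      = -(fun n : ℕ => if h : Odd n then (haveI : NeZero n := ⟨h.pos.ne'⟩;
        (JsB12CombShSym (Lc := n) h N (symTablesAn1S2w 3 n (cΛ (Nat.log Lc n)) (w (Nat.log Lc n))) (cΛ (Nat.log Lc n)) (cB (Nat.log Lc n)) 0).S) else 0) n κ u y x
        (Sum.inl b) (Sum.inl c) := by
  have h := pin_entry (fun n h => (haveI : NeZero n := ⟨h.pos.ne'⟩;
        (JsB12CombShSym (Lc := n) h N (symTablesAn1S2w 3 n (cΛ (Nat.log Lc n)) (w (Nat.log Lc n))) (cΛ (Nat.log Lc n)) (cB (Nat.log Lc n)) 0).S))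
    (-1) (Sum.inl c) (Sum.inl b) (Sum.inl c) (Sum.inl b) (fun n h κ u x y => by
    haveI : NeZero n := ⟨h.pos.ne'⟩
    rw [neg_one_mul]
    exact JsB12CombShSym_S_w_inl_inl h N _ _ _ _ 0 κ u x y c b) n κ u x y
  rw [neg_one_mul] at h
  exact h

/-! ## §3 Locality with the pinned constants (`hS ∕ hCs ∕ hδS`) -/

/-- [folklore] **`hS` OF THE PIN**: `LocStencil (S n) (Cs n) (δS n)` with the PINNED constants
`Cs n := if h : Odd n then (the dressed member).Cs else 0`, `δS n := if h : Odd n then (the dressed member).δ else 1` (the datum's own `JetData.loc`). -/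
theorem S_locStencil (n : ℕ) :
    LocStencil
      ((fun n : ℕ => if h : Odd n then (haveI : NeZero n := ⟨h.pos.ne'⟩;
        (JsB12CombShSym (Lc := n) h N (symTablesAn1S2w 3 n (cΛ (Nat.log Lc n)) (w (Nat.log Lc n))) (cΛ (Nat.log Lc n)) (cB (Nat.log Lc n)) 0).S) else 0) n)
      ((fun n : ℕ => if h : Odd n then (haveI : NeZero n := ⟨h.pos.ne'⟩;
        (JsB12CombShSym (Lc := n) h N (symTablesAn1S2w 3 n (cΛ (Nat.log Lc n)) (w (Nat.log Lc n))) (cΛ (Nat.log Lc n)) (cB (Nat.log Lc n)) 0).Cs) else 0) n)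
      ((fun n : ℕ => if h : Odd n then (haveI : NeZero n := ⟨h.pos.ne'⟩;
        (JsB12CombShSym (Lc := n) h N (symTablesAn1S2w 3 n (cΛ (Nat.log Lc n)) (w (Nat.log Lc n))) (cΛ (Nat.log Lc n)) (cB (Nat.log Lc n)) 0).δ) else 1) n) :=
  pin_locStencil (fun n h => (haveI : NeZero n := ⟨h.pos.ne'⟩;
        (JsB12CombShSym (Lc := n) h N (symTablesAn1S2w 3 n (cΛ (Nat.log Lc n)) (w (Nat.log Lc n))) (cΛ (Nat.log Lc n)) (cB (Nat.log Lc n)) 0).S))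
    (fun n h => (haveI : NeZero n := ⟨h.pos.ne'⟩;
        (JsB12CombShSym (Lc := n) h N (symTablesAn1S2w 3 n (cΛ (Nat.log Lc n)) (w (Nat.log Lc n))) (cΛ (Nat.log Lc n)) (cB (Nat.log Lc n)) 0).Cs))
    (fun n h => (haveI : NeZero n := ⟨h.pos.ne'⟩;
        (JsB12CombShSym (Lc := n) h N (symTablesAn1S2w 3 n (cΛ (Nat.log Lc n)) (w (Nat.log Lc n))) (cΛ (Nat.log Lc n)) (cB (Nat.log Lc n)) 0).δ))
    (fun n h => by
    haveI : NeZero n := ⟨h.pos.ne'⟩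
    exact (JsB12CombShSym (Lc := n) h N (symTablesAn1S2w 3 n (cΛ (Nat.log Lc n)) (w (Nat.log Lc n))) (cΛ (Nat.log Lc n)) (cB (Nat.log Lc n)) 0).loc) n

/-- [folklore] **`hCs` OF THE PIN**: the pinned constants are nonnegative (`JetData.loc` at one entry, `BiLoc.nonneg`). -/
theorem Cs_nonneg (n : ℕ) :
    0 ≤ (fun n : ℕ => if h : Odd n then (haveI : NeZero n := ⟨h.pos.ne'⟩;
        (JsB12CombShSym (Lc := n) h N (symTablesAn1S2w 3 n (cΛ (Nat.log Lc n)) (w (Nat.log Lc n))) (cΛ (Nat.log Lc n)) (cB (Nat.log Lc n)) 0).Cs) else 0) n :=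
  pin_Cs_nonneg (fun n h => (haveI : NeZero n := ⟨h.pos.ne'⟩;
        (JsB12CombShSym (Lc := n) h N (symTablesAn1S2w 3 n (cΛ (Nat.log Lc n)) (w (Nat.log Lc n))) (cΛ (Nat.log Lc n)) (cB (Nat.log Lc n)) 0).Cs))
    (fun n h => by
    haveI : NeZero n := ⟨h.pos.ne'⟩
    exact ((JsB12CombShSym (Lc := n) h N (symTablesAn1S2w 3 n (cΛ (Nat.log Lc n)) (w (Nat.log Lc n))) (cΛ (Nat.log Lc n)) (cB (Nat.log Lc n)) 0).loc 0 0).nonneg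
      (Sum.inl 0)) n

/-- [folklore] **`hδS` OF THE PIN**: the pinned rates are positive (`JetData.δ_pos`). -/
theorem δ_pos (n : ℕ) :
    0 < (fun n : ℕ => if h : Odd n then (haveI : NeZero n := ⟨h.pos.ne'⟩;
        (JsB12CombShSym (Lc := n) h N (symTablesAn1S2w 3 n (cΛ (Nat.log Lc n)) (w (Nat.log Lc n))) (cΛ (Nat.log Lc n)) (cB (Nat.log Lc n)) 0).δ) else 1) n :=
  pin_δ_pos (fun n h => (haveI : NeZero n := ⟨h.pos.ne'⟩;
        (JsB12CombShSym (Lc := n) h N (symTablesAn1S2w 3 n (cΛ (Nat.log Lc n)) (w (Nat.log Lc n))) (cΛ (Nat.log Lc n)) (cB (Nat.log Lc n)) 0).δ))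
    (fun n h => by
    haveI : NeZero n := ⟨h.pos.ne'⟩
    exact (JsB12CombShSym (Lc := n) h N (symTablesAn1S2w 3 n (cΛ (Nat.log Lc n)) (w (Nat.log Lc n))) (cΛ (Nat.log Lc n)) (cB (Nat.log Lc n)) 0).δ_pos) n

end Summit.QuantumFields.BalabanUV.Beta.D1BFx.RoadLitPinAn1W

end
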